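import Summits.BirchSwinnertonDyer.BirchSwinnertonDyer.Theorems.EisensteinPrimesFullDescentTateAlgebraThree
import HarnessLib

/-!
# Crux `GoodLatticeBDPValue` (stmt-BirchSwinnertonDyer-19032), line `halves`, road «R5 / AN-5» — brick TA-p:
# the level-`p` and level-`p²` ALGEBRA of a Tate basis for an ARBITRARY prime `p` (pure group theory, no field)

Width seat bsd-line-x1-p1-w3 (gen 13), cell `bsd-eis` (home `run/shared/lean/pub/bsd-eis/`). HONEST FRAMING:
TOOL THEOREMS ONLY (no `def`, no named fact, no `sorry`); nothing about a curve, a summit statement,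
Keller–Yin Thm. 2.2.2 or crux 2 is proved here; 0 stubs / cells / labels move.

WHY. Width seat w7 (gen 7)'s road «R5 / AN-5» (HOME STATUS 2026-08-28T21:34:45Z) derives the composed-print
name `KellerYin2024.thm222_anacong_goodLattice_of_five_le` (`stub_publishedFactsMore`, conjunct 2) from the 3a-A
name `thm222_anacong_goodLattice_of_fullDescentDatum` and a kernel theorem T‴ («full-descent datum at `5 ≤ p`
under the good-lattice normalisation»), by running the ELEMENTARY AN-3 road of
`HOME/line-x1-p1-w3-g4/AN3-StubB-elementary-road.md` (evidence #44 on the item) at level `p / p²` instead of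
`3 / 9`. At a split multiplicative `ℓ ≠ p` every local input is read off the TATE BASIS of the `N`-torsion
(`N = p, p²`) given by the tree's `FullDescentTateBasis.exists_tateBasis_geomPoints_of_hasSplitMultiplicativeReductionAt`
(Tate's uniformisation, DISCHARGED): `P₁ = Ψ(ζ_N)`, `P₂ = Ψ(q^{1/N})` generate the `N`-torsion with relations
`N ∣ a ∧ N ∣ b` and `σ • P₁ = χ(σ) • P₁`, `σ • P₂ = P₂ + κ(σ) • P₁` (Silverman, *ATAEC* V §3, Lemma V.5.2).
This file is the PURE ALGEBRA over such a basis (a group `G` acting on an abelian group `M`; integers `χ σ`,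
`κ σ`) — the token-for-token generalisation of w3 (gen 4)'s `…FullDescentTateAlgebraThree` (p652704) and
`…FullDescentTateAlgebraNine` (p652904) from `(3, 9)` to `(p, p²)`, `p` ANY prime; levels are written `(p : ℤ)`
and `((p ^ 2 : ℕ) : ℤ)` (verbatim the output shape of the Tate-basis theorem at `N = p ^ 2`):

* §4 `basis_prime_of_basis_sq` — a level-`p²` basis gives the level-`p` basis `(pP₁, pP₂)` with the same `χ, κ`;
* §5 level `p`: **`smul_eq_self_of_fixed_prime`** (T-a)ₚ — if some `σ₀` has `p ∤ χ σ₀ − 1` (`ζ_p ∉ ℚ_ℓ`,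
  `ℓ ≢ 1 (mod p)`) and the `p`-torsion has a NON-ZERO `G`-FIXED vector, then every `σ` with `p ∣ χ σ − 1`
  (inertia) fixes the whole `p`-torsion; **`smul_eq_self_of_mem_of_card_eq_prime`** (T-b)ₚ — such a `σ` fixes
  pointwise every `σ`-stable subgroup of order `p`; **`eq_zmultiples_fst_of_smul_eq_chi_prime`** (T-f)ₚ — a
  subgroup of order `p` on which `σ₀` acts as the scalar `χ σ₀` IS `ℤ • P₁` (the `ω`-line is the Tate line;
  road R5 step A1 «`C = ⟨P₁⟩` at a bad `ℓ`»);
* §6 level `p²`: **`smul_sub_mem_zmultiples_of_sq`** (T-d)ₚ — `σ` with `p² ∣ χ σ − 1` (inertia at `ℓ ≠ p`)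
  acts trivially on `p⁻¹(ℤ•pP₁) / (ℤ•pP₁)`, with NO condition on `κ` («`q″ = q^p` is a `p`-th power»; road R5
  step A2 «inertia-trivial at every `ℓ ≠ p`»); `addOrderOf_fst_eq_sq`; **`eq_zmultiples_fst_of_stable_sq`**
  (T-c)ₚ — a `σ₀`-stable subgroup `L` of order `p²` of `p²`-torsion elements whose `p`-torsion lies in
  `ℤ • pP₁` IS `ℤ • P₁ = Ψ(μ_{p²})` (road R5 steps A3/A4 «`L = Ψ(μ_{p²})` at a bad `ℓ`»).

References: [SilvermanATAEC1994] J. H. Silverman, *Advanced Topics in the Arithmetic of Elliptic Curves*,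
GTM 151, Ch. V Thm. 3.1 (c),(d), Lemma 5.2 (c), Thm. 5.3 (PDF pp. 394–410); [SerreInventiones1972]
J.-P. Serre, Invent. Math. 15 (1972) §1.12 (the exact sequence `0 → μ_N → E_q[N] → ℤ/N → 0`).
-/

set_option autoImplicit false
set_option linter.dupNamespace false

namespace Summit.BirchSwinnertonDyer.BirchSwinnertonDyer.Theorems.FullDescentTateAlgebra

variable {G M : Type*} [Group G] [AddCommGroup M] [DistribMulAction G M]
variable {p : ℕ} [hp : Fact p.Prime]

/-! ## §4. From level `p²` to level `p` -/

/-- `((p²  : ℕ) : ℤ) = p · p`. [folklore] -/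
theorem natCast_sq_eq_mul (p : ℕ) : ((p ^ 2 : ℕ) : ℤ) = (p : ℤ) * p := by
  push_cast; ring

/-- **A level-`p²` basis gives the level-`p` basis `(pP₁, pP₂)` with the same `χ, κ`** (the `p`-torsion of
the `p²`-torsion is generated by `pP₁ = Ψ(ζ_{p²}^p)` and `pP₂ = Ψ(q^{1/p})`). [cite: SilvermanATAEC1994, Thm. V.3.1 (c),(d)] -/
theorem basis_prime_of_basis_sq {P₁ P₂ : M} {χ κ : G → ℤ}
    (hgen : ∀ P : M, ((p ^ 2 : ℕ) : ℤ) • P = 0 → ∃ a b : ℤ, P = a • P₁ + b • P₂)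
    (hrel : ∀ a b : ℤ, a • P₁ + b • P₂ = 0 ↔ ((p ^ 2 : ℕ) : ℤ) ∣ a ∧ ((p ^ 2 : ℕ) : ℤ) ∣ b)
    (hP₁ : ∀ σ : G, σ • P₁ = χ σ • P₁) (hP₂ : ∀ σ : G, σ • P₂ = P₂ + κ σ • P₁) :
    (∀ P : M, (p : ℤ) • P = 0 → ∃ a b : ℤ, P = a • ((p : ℤ) • P₁) + b • ((p : ℤ) • P₂)) ∧
    (∀ a b : ℤ, a • ((p : ℤ) • P₁) + b • ((p : ℤ) • P₂) = 0 ↔ (p : ℤ) ∣ a ∧ (p : ℤ) ∣ b) ∧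
    (∀ σ : G, σ • ((p : ℤ) • P₁) = χ σ • ((p : ℤ) • P₁)) ∧
    (∀ σ : G, σ • ((p : ℤ) • P₂) = (p : ℤ) • P₂ + κ σ • ((p : ℤ) • P₁)) := by
  have hp0 : (p : ℤ) ≠ 0 := by exact_mod_cast hp.out.ne_zero
  have hsq : ((p ^ 2 : ℕ) : ℤ) = (p : ℤ) * p := natCast_sq_eq_mul p
  refine ⟨fun P hP ↦ ?_, fun a b ↦ ?_, fun σ ↦ ?_, fun σ ↦ ?_⟩
  · have hP2 : ((p ^ 2 : ℕ) : ℤ) • P = 0 := by rw [hsq, mul_smul, hP, smul_zero]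
    obtain ⟨a, b, rfl⟩ := hgen P hP2
    have h3 : ((p : ℤ) * a) • P₁ + ((p : ℤ) * b) • P₂ = 0 := by rw [← hP]; module
    obtain ⟨ha, hb⟩ := (hrel _ _).mp h3
    rw [hsq] at ha hb
    obtain ⟨a', rfl⟩ := (mul_dvd_mul_iff_left hp0).mp ha
    obtain ⟨b', rfl⟩ := (mul_dvd_mul_iff_left hp0).mp hb
    exact ⟨a', b', by module⟩
  · have h : a • ((p : ℤ) • P₁) + b • ((p : ℤ) • P₂) = ((p : ℤ) * a) • P₁ + ((p : ℤ) * b) • P₂ := by module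
    rw [h, hrel, hsq, mul_dvd_mul_iff_left hp0, mul_dvd_mul_iff_left hp0]
  · rw [smul_zsmul_comm, hP₁]; module
  · rw [smul_zsmul_comm, hP₂]; module

/-! ## §5. Level `p` -/

section Prime

variable {P₁ P₂ : M} {χ κ : G → ℤ}

/-- **(T-a)ₚ A non-zero fixed vector makes the inertia action trivial.** If the `p`-torsion is generated by a
Tate basis `(P₁, P₂)`, some `σ₀` has `p ∤ χ(σ₀) − 1` (so the Tate line `ℤ•P₁` carries a non-trivial
character: `ζ_p ∉ ℚ_ℓ`, i.e. `ℓ ≢ 1 (mod p)`), and some `P ≠ 0` of the `p`-torsion is fixed by ALL of `G`, then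
every `σ` with `p ∣ χ(σ) − 1` (the inertia group) fixes the whole `p`-torsion: `P = aP₁ + bP₂` must have
`p ∤ b`, and `σ P = P` forces `p ∣ κ(σ)`. (For the Tate curve: a rational `p`-torsion point off `Ψ(μ_p)` makes
`q` a `p`-th power, so `E[p]` is unramified; Silverman *ATAEC* V.5.3, Ex. 5.11.)
[cite: SilvermanATAEC1994, Lemma V.5.2, Thm. V.5.3] -/
theorem smul_eq_self_of_fixed_prime
    (hgen : ∀ P : M, (p : ℤ) • P = 0 → ∃ a b : ℤ, P = a • P₁ + b • P₂)
    (hrel : ∀ a b : ℤ, a • P₁ + b • P₂ = 0 ↔ (p : ℤ) ∣ a ∧ (p : ℤ) ∣ b)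
    (hP₁ : ∀ σ : G, σ • P₁ = χ σ • P₁) (hP₂ : ∀ σ : G, σ • P₂ = P₂ + κ σ • P₁)
    {σ₀ : G} (hσ₀ : ¬ (p : ℤ) ∣ χ σ₀ - 1)
    {P : M} (hPp : (p : ℤ) • P = 0) (hP0 : P ≠ 0) (hfix : ∀ σ : G, σ • P = P)
    {σ : G} (hχσ : (p : ℤ) ∣ χ σ - 1) {x : M} (hx : (p : ℤ) • x = 0) : σ • x = x := by
  have hpZ : Prime (p : ℤ) := Nat.prime_iff_prime_int.mp hp.out
  obtain ⟨a, b, rfl⟩ := hgen P hPp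
  -- the coefficient constraint given by `τ • P = P`
  have hcoef : ∀ τ : G, (p : ℤ) ∣ a * (χ τ - 1) + b * κ τ := by
    intro τ
    have h := hfix τ
    rw [smul_comb hP₁ hP₂] at h
    have h' := ((comb_eq_comb_iff hrel _ _ _ _).mp h).1
    have e : a * χ τ + b * κ τ - a = a * (χ τ - 1) + b * κ τ := by ring
    rwa [e] at h'
  -- `p ∤ b`: otherwise `σ₀ • P = P` would force `p ∣ a`, i.e. `P = 0`
  have hb : ¬ (p : ℤ) ∣ b := by
    intro hb
    have h1 : (p : ℤ) ∣ a * (χ σ₀ - 1) := by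
      simpa using dvd_sub (hcoef σ₀) (Dvd.dvd.mul_right hb (κ σ₀))
    have ha : (p : ℤ) ∣ a := by
      rcases hpZ.dvd_or_dvd h1 with h | h
      · exact h
      · exact absurd h hσ₀
    exact hP0 ((hrel a b).mpr ⟨ha, hb⟩)
  -- `σ • P = P` with `p ∣ χ σ - 1` forces `p ∣ κ σ`
  have hκ : (p : ℤ) ∣ κ σ := by
    have h1 : (p : ℤ) ∣ b * κ σ := by simpa using dvd_sub (hcoef σ) (Dvd.dvd.mul_left hχσ a)
    rcases hpZ.dvd_or_dvd h1 with h | h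
    · exact absurd h hb
    · exact h
  -- hence `σ` fixes every `p`-torsion element
  obtain ⟨a', b', rfl⟩ := hgen x hx
  rw [smul_comb hP₁ hP₂, comb_eq_comb_iff hrel]
  refine ⟨?_, by simp⟩
  have e : a' * χ σ + b' * κ σ - a' = a' * (χ σ - 1) + b' * κ σ := by ring
  rw [e]
  exact dvd_add (Dvd.dvd.mul_left hχσ a') (Dvd.dvd.mul_left hκ b')

/-- **(T-b)ₚ Inertia fixes every stable line pointwise** (the isogeny character is unramified at a multiplicative
`ℓ ≠ p`). If `σ` has `p ∣ χ(σ) − 1` (inertia) then `σ` acts unipotently on the `p`-torsion (`σ x − x ∈ ℤ • P₁`,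
`σ P₁ = P₁`), hence trivially on every `σ`-stable subgroup of order `p`: were `σ x − x = c P₁ ≠ 0` in `H`, then
`H = ℤ • cP₁ ∋ x` would give `p ∣ b` and `c ≡ 0`. [cite: SilvermanATAEC1994, Lemma V.5.2] [cite: SerreInventiones1972, §1.12] -/
theorem smul_eq_self_of_mem_of_card_eq_prime
    (hgen : ∀ P : M, (p : ℤ) • P = 0 → ∃ a b : ℤ, P = a • P₁ + b • P₂)
    (hrel : ∀ a b : ℤ, a • P₁ + b • P₂ = 0 ↔ (p : ℤ) ∣ a ∧ (p : ℤ) ∣ b)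
    (hP₁ : ∀ σ : G, σ • P₁ = χ σ • P₁) (hP₂ : ∀ σ : G, σ • P₂ = P₂ + κ σ • P₁)
    {σ : G} (hχσ : (p : ℤ) ∣ χ σ - 1) {H : AddSubgroup M} (hH : Nat.card H = p)
    (hst : ∀ x ∈ H, σ • x ∈ H) {x : M} (hx : x ∈ H) : σ • x = x := by
  have hpZ : Prime (p : ℤ) := Nat.prime_iff_prime_int.mp hp.out
  have hxp : (p : ℤ) • x = 0 := natCast_card_zsmul_eq_zero_of_mem hH hx
  obtain ⟨a, b, rfl⟩ := hgen x hxp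
  -- `σ x - x = c • P₁` with `c = a (χ σ - 1) + b κ σ`
  set c : ℤ := a * (χ σ - 1) + b * κ σ with hc
  have hdiff : σ • (a • P₁ + b • P₂) - (a • P₁ + b • P₂) = c • P₁ := by rw [smul_comb hP₁ hP₂, hc]; module
  have hmem : c • P₁ ∈ H := by rw [← hdiff]; exact H.sub_mem (hst _ hx) hx
  -- if `p ∣ c` we are done
  by_cases hpc : (p : ℤ) ∣ c
  · rw [← sub_eq_zero, hdiff]
    simpa using (comb_eq_comb_iff hrel c 0 0 0).mpr ⟨by simpa using hpc, by simp⟩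
  · -- otherwise `c • P₁` generates `H`, so `x` is a multiple of `P₁`: `p ∣ b`, and then `p ∣ c` after all
    exfalso
    have hc0 : c • P₁ ≠ 0 := fun h0 ↦ hpc ((hrel c 0).mp (by simpa using h0)).1
    obtain ⟨m, hm⟩ := exists_zsmul_eq_of_card_eq_prime hH hmem hc0 hx
    have hb : (p : ℤ) ∣ b := by
      have h := ((comb_eq_comb_iff hrel (m * c) 0 a b).mp (by rw [← hm]; module)).2
      rwa [zero_sub, dvd_neg] at h
    apply hpc
    rw [hc]
    exact dvd_add (Dvd.dvd.mul_left hχσ a) (Dvd.dvd.mul_right hb _)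

/-- **(T-f)ₚ The `ω`-line is the Tate line** (road R5 step A1). A subgroup `H` of order `p` on which some `σ₀`
with `p ∤ χ(σ₀) − 1` acts as the scalar `χ(σ₀)` is `ℤ • P₁`: for `x = aP₁ + bP₂ ∈ H`, `σ₀ x = χ(σ₀) x` gives
`p ∣ b (χ(σ₀) − 1)`, so `p ∣ b`. [cite: SilvermanATAEC1994, Lemma V.5.2] -/
theorem eq_zmultiples_fst_of_smul_eq_chi_prime
    (hgen : ∀ P : M, (p : ℤ) • P = 0 → ∃ a b : ℤ, P = a • P₁ + b • P₂)
    (hrel : ∀ a b : ℤ, a • P₁ + b • P₂ = 0 ↔ (p : ℤ) ∣ a ∧ (p : ℤ) ∣ b)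
    (hP₁ : ∀ σ : G, σ • P₁ = χ σ • P₁) (hP₂ : ∀ σ : G, σ • P₂ = P₂ + κ σ • P₁)
    {σ₀ : G} (hσ₀ : ¬ (p : ℤ) ∣ χ σ₀ - 1) {H : AddSubgroup M} (hH : Nat.card H = p)
    (hact : ∀ x ∈ H, σ₀ • x = χ σ₀ • x) : H = AddSubgroup.zmultiples P₁ := by
  have hpZ : Prime (p : ℤ) := Nat.prime_iff_prime_int.mp hp.out
  -- `H ≤ ℤ • P₁`
  have hle : H ≤ AddSubgroup.zmultiples P₁ := by
    intro x hx
    have hxp : (p : ℤ) • x = 0 := natCast_card_zsmul_eq_zero_of_mem hH hx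
    obtain ⟨a, b, rfl⟩ := hgen x hxp
    have h := hact _ hx
    rw [smul_comb hP₁ hP₂, smul_add, smul_smul, smul_smul] at h
    have h' := ((comb_eq_comb_iff hrel _ _ _ _).mp h).2
    have e : b - χ σ₀ * b = -(b * (χ σ₀ - 1)) := by ring
    rw [e, dvd_neg] at h'
    have hb : (p : ℤ) ∣ b := by
      rcases hpZ.dvd_or_dvd h' with h | h
      · exact h
      · exact absurd h hσ₀
    have hx' : a • P₁ + b • P₂ = a • P₁ + (0 : ℤ) • P₂ :=
      (comb_eq_comb_iff hrel _ _ _ _).mpr ⟨by simp, by simpa using hb⟩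
    rw [hx', zero_smul, add_zero]
    exact AddSubgroup.zsmul_mem_zmultiples P₁ a
  -- and both have order `p`
  have hP₁0 : P₁ ≠ 0 := fst_ne_zero hrel hp.out.one_lt.ne'
  have hP₁p : p • P₁ = 0 := by
    rw [← natCast_zsmul]; exact natCast_zsmul_fst_eq_zero hrel
  have hcard : Nat.card (AddSubgroup.zmultiples P₁) = p := by
    rw [Nat.card_zmultiples, addOrderOf_eq_prime hP₁p hP₁0]
  haveI : Finite (AddSubgroup.zmultiples P₁) :=
    Nat.finite_of_card_ne_zero (by rw [hcard]; exact hp.out.ne_zero)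
  exact AddSubgroup.eq_of_le_of_card_ge hle (by rw [hH, hcard])

end Prime

/-! ## §6. Level `p²` -/

section Square

variable {P₁ P₂ : M} {χ κ : G → ℤ}

/-- **(T-d)ₚ Inertia acts trivially on `p⁻¹C / C`, `C = ℤ • pP₁`** (road R5 step A2: no condition on `κ`, i.e. on
`q` — «`q″ = q^p` is a `p`-th power»): if `p² ∣ χ(σ) − 1` and `x` is a `p²`-torsion element with `px ∈ ℤ • pP₁`,
then `σ x − x ∈ ℤ • pP₁`. [cite: SilvermanATAEC1994, Lemma V.5.2] -/
theorem smul_sub_mem_zmultiples_of_sq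
    (hgen : ∀ P : M, ((p ^ 2 : ℕ) : ℤ) • P = 0 → ∃ a b : ℤ, P = a • P₁ + b • P₂)
    (hrel : ∀ a b : ℤ, a • P₁ + b • P₂ = 0 ↔ ((p ^ 2 : ℕ) : ℤ) ∣ a ∧ ((p ^ 2 : ℕ) : ℤ) ∣ b)
    (hP₁ : ∀ σ : G, σ • P₁ = χ σ • P₁) (hP₂ : ∀ σ : G, σ • P₂ = P₂ + κ σ • P₁)
    {σ : G} (hχσ : ((p ^ 2 : ℕ) : ℤ) ∣ χ σ - 1) {x : M} (hx2 : ((p ^ 2 : ℕ) : ℤ) • x = 0)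
    (hxp : (p : ℤ) • x ∈ AddSubgroup.zmultiples ((p : ℤ) • P₁)) :
    σ • x - x ∈ AddSubgroup.zmultiples ((p : ℤ) • P₁) := by
  have hp0 : (p : ℤ) ≠ 0 := by exact_mod_cast hp.out.ne_zero
  have hsq : ((p ^ 2 : ℕ) : ℤ) = (p : ℤ) * p := natCast_sq_eq_mul p
  obtain ⟨a, b, rfl⟩ := hgen x hx2
  obtain ⟨m, hm⟩ := AddSubgroup.mem_zmultiples_iff.mp hxp
  -- `px = pm P₁` gives `p² ∣ pb`, i.e. `p ∣ b`
  have hb : (p : ℤ) ∣ b := by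
    have h : ((p : ℤ) * a) • P₁ + ((p : ℤ) * b) • P₂ = ((p : ℤ) * m) • P₁ + (0 : ℤ) • P₂ := by
      rw [show ((p : ℤ) * a) • P₁ + ((p : ℤ) * b) • P₂ = (p : ℤ) • (a • P₁ + b • P₂) by module, ← hm]
      module
    have h' := ((comb_eq_comb_iff hrel _ _ _ _).mp h).2
    rw [sub_zero, hsq, mul_dvd_mul_iff_left hp0] at h'
    exact h'
  obtain ⟨t, ht⟩ := hχσ
  obtain ⟨b', rfl⟩ := hb
  refine AddSubgroup.mem_zmultiples_iff.mpr ⟨(p : ℤ) * a * t + b' * κ σ, ?_⟩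
  have hχ' : χ σ = (p : ℤ) * p * t + 1 := by
    rw [← hsq, ← ht]; ring
  rw [smul_comb hP₁ hP₂, hχ']
  module

/-- The element `P₁` of a level-`p²` Tate basis has additive order `p²`. [folklore] -/
theorem addOrderOf_fst_eq_sq
    (hrel : ∀ a b : ℤ, a • P₁ + b • P₂ = 0 ↔ ((p ^ 2 : ℕ) : ℤ) ∣ a ∧ ((p ^ 2 : ℕ) : ℤ) ∣ b) :
    addOrderOf P₁ = p ^ 2 := by
  have hpZ : Prime (p : ℤ) := Nat.prime_iff_prime_int.mp hp.out
  have hp0 : (p : ℤ) ≠ 0 := by exact_mod_cast hp.out.ne_zero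
  have hsq : ((p ^ 2 : ℕ) : ℤ) = (p : ℤ) * p := natCast_sq_eq_mul p
  have h2 : p ^ (1 + 1) • P₁ = 0 := by
    have h := (hrel ((p ^ 2 : ℕ) : ℤ) 0).mpr ⟨dvd_rfl, dvd_zero _⟩
    rw [← natCast_zsmul]
    simpa using h
  have h1 : ¬ p ^ 1 • P₁ = 0 := by
    intro h0
    have h : (p : ℤ) • P₁ + (0 : ℤ) • P₂ = 0 := by
      rw [pow_one, ← natCast_zsmul] at h0
      simpa using h0
    have hd := ((hrel (p : ℤ) 0).mp h).1
    rw [hsq] at hd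
    exact hpZ.not_dvd_one ((mul_dvd_mul_iff_left hp0).mp (by simpa using hd))
  simpa using addOrderOf_eq_prime_pow h1 h2

/-- **(T-c)ₚ The unique stable cyclic group of order `p²` over the Tate line is `Ψ(μ_{p²})`** (road R5 steps A3/A4).
Let `L` be a subgroup of order `p²` of `p²`-torsion elements, stable under some `σ₀` with `p ∤ χ(σ₀) − 1`
(`ζ_p ∉ ℚ_ℓ`), whose `p`-torsion lies in `ℤ • pP₁`. Then `L = ℤ • P₁`: `L` is generated by some `x = aP₁ + bP₂` of
order `p²` with `p ∣ b`, `p ∤ a`; `σ₀ x = m x` forces `m ≡ χ(σ₀) (mod p)` and `p² ∣ b (1 − m)`, so `p² ∣ b`.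
[cite: SilvermanATAEC1994, Lemma V.5.2] -/
theorem eq_zmultiples_fst_of_stable_sq
    (hgen : ∀ P : M, ((p ^ 2 : ℕ) : ℤ) • P = 0 → ∃ a b : ℤ, P = a • P₁ + b • P₂)
    (hrel : ∀ a b : ℤ, a • P₁ + b • P₂ = 0 ↔ ((p ^ 2 : ℕ) : ℤ) ∣ a ∧ ((p ^ 2 : ℕ) : ℤ) ∣ b)
    (hP₁ : ∀ σ : G, σ • P₁ = χ σ • P₁) (hP₂ : ∀ σ : G, σ • P₂ = P₂ + κ σ • P₁)
    {σ₀ : G} (hσ₀ : ¬ (p : ℤ) ∣ χ σ₀ - 1) {L : AddSubgroup M} (hL : Nat.card L = p ^ 2)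
    (hL2 : ∀ x ∈ L, ((p ^ 2 : ℕ) : ℤ) • x = 0) (hst : ∀ x ∈ L, σ₀ • x ∈ L)
    (hLp : ∀ x ∈ L, (p : ℤ) • x = 0 → x ∈ AddSubgroup.zmultiples ((p : ℤ) • P₁)) :
    L = AddSubgroup.zmultiples P₁ := by
  have hpp := hp.out
  have hpZ : Prime (p : ℤ) := Nat.prime_iff_prime_int.mp hpp
  have hp0 : (p : ℤ) ≠ 0 := by exact_mod_cast hpp.ne_zero
  have hsq : ((p ^ 2 : ℕ) : ℤ) = (p : ℤ) * p := natCast_sq_eq_mul p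
  have hpsq : (p : ℤ) ∣ ((p ^ 2 : ℕ) : ℤ) := by
    rw [hsq]; exact dvd_mul_right _ _
  have hp2ne : p ^ 2 ≠ 0 := pow_ne_zero _ hpp.ne_zero
  haveI hLfin : Finite L := Nat.finite_of_card_ne_zero (by rw [hL]; exact hp2ne)
  -- the order of `P₁` and of `pP₁`
  have hordP₁ : addOrderOf P₁ = p ^ 2 := addOrderOf_fst_eq_sq hrel
  have hpP₁0 : (p : ℤ) • P₁ ≠ 0 := by
    intro h0
    have hd := ((hrel (p : ℤ) 0).mp (by simpa using h0)).1
    rw [hsq] at hd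
    exact hpZ.not_dvd_one ((mul_dvd_mul_iff_left hp0).mp (by simpa using hd))
  have hordp : addOrderOf ((p : ℤ) • P₁) = p := by
    refine addOrderOf_eq_prime ?_ hpP₁0
    rw [← natCast_zsmul, smul_smul, ← hsq]
    have h := (hrel ((p ^ 2 : ℕ) : ℤ) 0).mpr ⟨dvd_rfl, dvd_zero _⟩
    simpa using h
  -- `L` has an element `x` with `px ≠ 0` (else `L ≤ ℤ•pP₁`, of order `p < p²`)
  obtain ⟨x, hxL, hxp⟩ : ∃ x ∈ L, (p : ℤ) • x ≠ 0 := by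
    by_contra! hall
    have hle : L ≤ AddSubgroup.zmultiples ((p : ℤ) • P₁) := fun y hy ↦ hLp y hy (hall y hy)
    haveI : Finite (AddSubgroup.zmultiples ((p : ℤ) • P₁)) :=
      Nat.finite_of_card_ne_zero (by rw [Nat.card_zmultiples, hordp]; exact hpp.ne_zero)
    have hcard := AddSubgroup.card_le_of_le hle
    rw [hL, Nat.card_zmultiples, hordp] at hcard
    have hlt : p < p ^ 2 := by
      have h := Nat.pow_lt_pow_right hpp.one_lt (by norm_num : 1 < 2)
      simpa using h
    omega
  -- `x = aP₁ + bP₂` with `p ∣ b` and `p ∤ a`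
  obtain ⟨a, b, rfl⟩ := hgen x (hL2 x hxL)
  have hxpmem : (p : ℤ) • (a • P₁ + b • P₂) ∈ AddSubgroup.zmultiples ((p : ℤ) • P₁) :=
    hLp _ (L.zsmul_mem hxL (p : ℤ)) (by rw [smul_smul, ← hsq]; exact hL2 _ hxL)
  obtain ⟨m, hm⟩ := AddSubgroup.mem_zmultiples_iff.mp hxpmem
  have hab : ((p ^ 2 : ℕ) : ℤ) ∣ (p : ℤ) * a - (p : ℤ) * m ∧ ((p ^ 2 : ℕ) : ℤ) ∣ (p : ℤ) * b - 0 := by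
    have h : ((p : ℤ) * a) • P₁ + ((p : ℤ) * b) • P₂ = ((p : ℤ) * m) • P₁ + (0 : ℤ) • P₂ := by
      rw [show ((p : ℤ) * a) • P₁ + ((p : ℤ) * b) • P₂ = (p : ℤ) • (a • P₁ + b • P₂) by module, ← hm]
      module
    exact (comb_eq_comb_iff hrel _ _ _ _).mp h
  have hb : (p : ℤ) ∣ b := by
    have h := hab.2
    rw [sub_zero, hsq, mul_dvd_mul_iff_left hp0] at h
    exact h
  have ha : ¬ (p : ℤ) ∣ a := by
    intro ha
    apply hxp
    have h : ((p : ℤ) * a) • P₁ + ((p : ℤ) * b) • P₂ = 0 :=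
      (hrel _ _).mpr ⟨by rw [hsq]; exact mul_dvd_mul_left _ ha, by rw [hsq]; exact mul_dvd_mul_left _ hb⟩
    rw [show (p : ℤ) • (a • P₁ + b • P₂) = ((p : ℤ) * a) • P₁ + ((p : ℤ) * b) • P₂ by module, h]
  -- `x` has order `p²`, so `L = ℤ • x`
  have hordx : addOrderOf (a • P₁ + b • P₂) = p ^ 2 := by
    have h2 : p ^ (1 + 1) • (a • P₁ + b • P₂) = 0 := by
      rw [← natCast_zsmul]
      have h := hL2 _ hxL
      simpa using h
    have h1 : ¬ p ^ 1 • (a • P₁ + b • P₂) = 0 := by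
      rw [pow_one, ← natCast_zsmul]; exact hxp
    simpa using addOrderOf_eq_prime_pow h1 h2
  have hLx : L = AddSubgroup.zmultiples (a • P₁ + b • P₂) := by
    haveI : Finite (AddSubgroup.zmultiples (a • P₁ + b • P₂)) :=
      Nat.finite_of_card_ne_zero (by rw [Nat.card_zmultiples, hordx]; exact hp2ne)
    refine (AddSubgroup.eq_of_le_of_card_ge (AddSubgroup.zmultiples_le.mpr hxL) ?_).symm
    rw [hL, Nat.card_zmultiples, hordx]
  -- `σ₀ x = m' x`
  have hσx : σ₀ • (a • P₁ + b • P₂) ∈ AddSubgroup.zmultiples (a • P₁ + b • P₂) := by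
    rw [← hLx]; exact hst _ hxL
  obtain ⟨m', hm'⟩ := AddSubgroup.mem_zmultiples_iff.mp hσx
  rw [smul_comb hP₁ hP₂] at hm'
  have hcoef := (comb_eq_comb_iff hrel _ _ _ _).mp (by rw [← hm']; module :
    (m' * a) • P₁ + (m' * b) • P₂ = (a * χ σ₀ + b * κ σ₀) • P₁ + b • P₂)
  obtain ⟨h1, h2⟩ := hcoef
  -- mod `p`: `p ∣ a (m' - χ σ₀)` hence `p ∣ m' - χ σ₀`, so `p ∤ m' - 1`
  obtain ⟨b', rfl⟩ := hb
  have h1' : (p : ℤ) ∣ a * (m' - χ σ₀) := by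
    have e : a * (m' - χ σ₀) =
        (m' * a - (a * χ σ₀ + (p : ℤ) * b' * κ σ₀)) + (p : ℤ) * (b' * κ σ₀) := by ring
    rw [e]
    exact dvd_add (hpsq.trans h1) (dvd_mul_right _ _)
  have hmχ : (p : ℤ) ∣ m' - χ σ₀ := by
    rcases hpZ.dvd_or_dvd h1' with h | h
    · exact absurd h ha
    · exact h
  have hm1 : ¬ (p : ℤ) ∣ m' - 1 := by
    intro h
    apply hσ₀
    have e : χ σ₀ - 1 = (m' - 1) - (m' - χ σ₀) := by ring
    rw [e]
    exact dvd_sub h hmχ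
  -- `p² ∣ pb'(m' - 1)` hence `p ∣ b'`
  have hb'p : (p : ℤ) ∣ b' * (m' - 1) := by
    have e : m' * ((p : ℤ) * b') - (p : ℤ) * b' = (p : ℤ) * (b' * (m' - 1)) := by ring
    rw [e, hsq, mul_dvd_mul_iff_left hp0] at h2
    exact h2
  have hb' : (p : ℤ) ∣ b' := by
    rcases hpZ.dvd_or_dvd hb'p with h | h
    · exact h
    · exact absurd h hm1
  -- so `x = a P₁` and `L = ℤ • aP₁ ≤ ℤ • P₁`; equal orders finish
  obtain ⟨b'', rfl⟩ := hb'
  have hx' : a • P₁ + ((p : ℤ) * ((p : ℤ) * b'')) • P₂ = a • P₁ := by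
    have h := (comb_eq_comb_iff hrel a ((p : ℤ) * ((p : ℤ) * b'')) a 0).mpr
      ⟨by simp, by rw [sub_zero, hsq, ← mul_assoc]; exact dvd_mul_right _ _⟩
    simpa using h
  rw [hx'] at hLx
  have hle : L ≤ AddSubgroup.zmultiples P₁ := by
    rw [hLx, AddSubgroup.zmultiples_le]
    exact AddSubgroup.zsmul_mem_zmultiples P₁ a
  haveI : Finite (AddSubgroup.zmultiples P₁) :=
    Nat.finite_of_card_ne_zero (by rw [Nat.card_zmultiples, hordP₁]; exact hp2ne)
  exact AddSubgroup.eq_of_le_of_card_ge hle (by rw [hL, Nat.card_zmultiples, hordP₁])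

end Square

end Summit.BirchSwinnertonDyer.BirchSwinnertonDyer.Theorems.FullDescentTateAlgebra
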